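import Summits.QuantumFields.BalabanUV.Beta.RootedT2JetReflection
import Summits.QuantumFields.BalabanUV.Beta.RootedJetDictionary
import Summits.QuantumFields.BalabanUV.Beta.RootedMixedJetReflectionLaw

/-!
# RootedT2JetDictionary — 33J: the components of the reflected `T2At` jets as node-7aρ functionals

b2b / pub-balaban, unit `b2b-balaban-beta-an3` gen 33 (letter supplier AN3, border chain «B», file 2 of 3), BINDER-OWNERS
row D1 / typer row HR-W-LET.  Pure algebra over any ring `𝔸` and field `𝕜`; no analysis, no measure, no new constants.

HONEST FRAMING. «discharging BetaPertH makes Bałaban's UV stability UNCONDITIONAL — a real constructive-QFT result; it is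
NOT the continuum limit and NOT the Clay problem.»
HONEST DEPENDENCY. «continuum YM on T⁴ ⇐ BetaPertH ∧ nine spine estimates (0/9 proved); BetaPertH ⇐ (D1) ∧ (D4) ∧ CAP+tail;
G-an2-4 gates asym, D1 and NE2/3/4.»  This file discharges NO binder of row D1; with 33I it is the jet-level part of the
proof of BX2's bond-level border law `hB` (`BorderLetterPacking.borderInv_of_bondLaw`); 33K evaluates at single letters.

## Content (all `[folklore]`: nested dual numbers and the rooted averaging calculus of nodes 12/12b, 33D–33I, 33M2, 33M3a)

Write `ℓ = L^d`, `Z = linAvgAt ρ`, `b = R1g α B`, `c = R1g α B′`.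
* §1 THE LETTERS OF 33I AT A SCALAR FLUCTUATION `ω = upF W`: `R1g α (upF W) = upF (R1g α W)`, `ad1R α (upF W) B =
  upF (D1R α W W B)` (33M2's axis commutator letter), `ad12R α (upF W) B B′ = upF (A12R α W B B′)` (the iterated one),
  and the scalar shadow of `R1g α (upF W)` is `upF (R1g α W)`.
* §2 BACKGROUND SIGN FLIPS: the `τ₂`-flip `flip2` (twin of 33H `flip1`); `Q(upF W; −B, B′) = flip1 Q(upF W; B, B′)`,
  `Q(upF W; B, −B′) = flip2 Q(…)`; hence `T2At ρ (upF W) (−B) B′ = −T2At ρ (upF W) B B′ = T2At ρ (upF W) B (−B′)`.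
* §3 THE NORMALISED ONE-PARAMETER COMPUTATION (rooted twin of node 12 `c11_logT_PhiY`):
  `c11 logT (Φ^ρ(Y(W;B)) · Φ^ρ(Y(0;B))⁻¹) = (2ℓ²)⁻¹ • vhUAt ρ W B`, via `c10 Φ^ρ(Y(W;B)) = ℓ⁻¹ Z_B`, `c01 = ℓ⁻¹ Z_W`,
  `Φ^ρ(Y(0;B)) = mk 1 (ℓ⁻¹ Z_B) 0 0` (33M3a `PhiGAt_X1`, `c11_logT_PhiGAt_Y`, 33H `lineHom`).
* §4 ORDERS `B⁰`, `B¹` OF THE ROOTED JET (rooted twins of node 12 `c00_Qjet`/`c10_Qjet`/`c01_Qjet`):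
  `c00 Q^ρ(upF W; B, B′) = ℓ⁻¹ • Z_W`, `c10 Q^ρ = (2ℓ²)⁻¹ • vhUAt ρ W B`, `c01 Q^ρ = (2ℓ²)⁻¹ • vhUAt ρ W B′`.
* §5 THE BACKGROUND `NR` OF 33I §4: `NR = Φ^ρ(E♯, Ē♯)`; `c10 NR = ℓ⁻¹ Z_b`, `c01 NR = ℓ⁻¹ Z_c`,
  `c11 NR = (2ℓ)⁻¹ (hessUAt ρ b c + Z[b,c]) + ℓ⁻¹ Z(dR) + (2ℓ²)⁻¹ {Z_b, Z_c}` (33G `reflPair_Ebg_Ebi`, 33M3a `PhiGAt_add_top`).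

## What is NOT here
No single letters, no `(0,3)` entries, no table: 33K (`RootedBorderTableLaw`) lands `hB` verbatim from 33I + this file.
-/

namespace Summit.QuantumFields.BalabanUV.Beta.RootedT2JetDictionary

open Finset
open Literature.MathematicalPhysics.QuantumFieldTheory.Balaban1983to89
open Literature.MathematicalPhysics.QuantumFieldTheory.Balaban1983to89.Beta
open Literature.MathematicalPhysics.QuantumFieldTheory.Balaban1983to89.Beta.AffineAveraging
open Literature.MathematicalPhysics.QuantumFieldTheory.Balaban1983to89.Beta.AveragingContours
open Literature.MathematicalPhysics.QuantumFieldTheory.Balaban1983to89.Beta.AveragingContoursRooted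
open Literature.MathematicalPhysics.QuantumFieldTheory.Balaban1983to89.Beta.TransportedContourVariables
open Literature.MathematicalPhysics.QuantumFieldTheory.Balaban1983to89.Beta.AveragingHessianKernels
open Literature.MathematicalPhysics.QuantumFieldTheory.Balaban1983to89.Beta.AveragingHessianKernelsRooted
open Literature.MathematicalPhysics.QuantumFieldTheory.Balaban1983to89.Beta.AveragingThirdJet
open Literature.MathematicalPhysics.QuantumFieldTheory.Balaban1983to89.Beta.AveragingThirdJet.Tau
open Literature.MathematicalPhysics.QuantumFieldTheory.Balaban1983to89.Beta.AveragingMixedJetTables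
open ResolventReflection (sref bref)
open Summit.QuantumFields.BalabanUV.Beta.RootedHolonomyReflection (R1g)
open Summit.QuantumFields.BalabanUV.Beta.RootedHolonomyReflectionHol (reflPair)
open Summit.QuantumFields.BalabanUV.Beta.RootedJetReflection (GfL GbL PhiLAt QjetLAt QjetAt_eq_QjetLAt fst_GfL fst_GbL)
open Summit.QuantumFields.BalabanUV.Beta.RootedJetReflectionExpanded (ι_neg dR reflPair_Ebg_Ebi reflPair_Ebi_Ebg ad1R ad12R)
open Summit.QuantumFields.BalabanUV.Beta.RootedJetTwist (lineHom flip1 flip1_ι map_QjetLAt)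
open Summit.QuantumFields.BalabanUV.Beta.RootedJetDictionary (inv_smul_sum_box_loopCAt PhiGAt_X1 snd_PhiGAt_X1
  c11_logT_PhiGAt_Y c00_PhiGAt PhiGAt_add_top linAvgAt_bw_swap)
open Summit.QuantumFields.BalabanUV.Beta.RootedMixedJetReflectionLaw (D1R)
open Summit.QuantumFields.BalabanUV.Beta.RootedT2JetReflection (NR)

variable {𝕜 : Type*} [Field 𝕜] {d : ℕ} {𝔸 : Type*} [Ring 𝔸] [Algebra 𝕜 𝔸]

/-! ## §1 The letters of 33I at a scalar fluctuation -/

/-- [folklore] The signed pull-back commutes with the scalar embedding: `R1g α (upF W) = upF (R1g α W)`. -/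
theorem R1g_upF (α : Fin d) (W : Form1 d 𝔸) : R1g α (upF W) = upF (R1g α W) := by
  funext κ x
  by_cases h : κ = α
  · subst h; simp [R1g, upF]
  · simp [R1g, upF, h]

/-- [folklore] … hence the scalar shadow of the reflected fluctuation is `upF (R1g α W)`. -/
theorem shadow_upF (α : Fin d) (W : Form1 d 𝔸) : (fun κ x => ι (c00 (R1g α (upF W) κ x))) = upF (R1g α W) := by
  rw [R1g_upF]; funext κ x; simp [upF]

/-- [folklore] The axis commutator letter of 33G at a scalar fluctuation is 33M2's `D1R`: `ad1R α (upF W) B = upF (D1R α W W B)`. -/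
theorem ad1R_upF (α : Fin d) (W B : Form1 d 𝔸) : ad1R α (upF W) B = upF (D1R α W W B) := by
  funext κ x
  simp only [ad1R, D1R, R1g_upF, upF]
  by_cases h : κ = α
  · simp only [h, if_true]; exact ext4 (by simp) (by simp) (by simp) (by simp)
  · simp [h]

/-- [folklore] THE ITERATED AXIS COMMUTATOR LETTER (scalar form of 33G `ad12R`): `𝟙_{κ=α} (c · [b, w] − [b, w] · c)`,
`w = R1g α W`, `b = R1g α B`, `c = R1g α B′`. -/
def A12R (α : Fin d) (W B B' : Form1 d 𝔸) : Form1 d 𝔸 := fun κ x =>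
  if κ = α then R1g α B' κ x * (R1g α B κ x * R1g α W κ x - R1g α W κ x * R1g α B κ x)
    - (R1g α B κ x * R1g α W κ x - R1g α W κ x * R1g α B κ x) * R1g α B' κ x else 0

/-- [folklore] `ad12R α (upF W) B B′ = upF (A12R α W B B′)`. -/
theorem ad12R_upF (α : Fin d) (W B B' : Form1 d 𝔸) : ad12R α (upF W) B B' = upF (A12R α W B B') := by
  funext κ x
  simp only [ad12R, A12R, R1g_upF, upF]
  by_cases h : κ = α
  · simp only [h, if_true]; exact ext4 (by simp [mul_sub, sub_mul, mul_assoc]) (by simp) (by simp) (by simp)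
  · simp [h]

/-! ## §2 Background sign flips -/

/-- [folklore] THE `τ₂`-SIGN FLIP `τ₂ ↦ −τ₂` (`τ₁` fixed): `mk a b c e ↦ mk a b (−c) (−e)` (twin of 33H `flip1`). -/
def flip2 : Tau 𝔸 →ₐ[𝕜] Tau 𝔸 := scaleDual (𝕜 := 𝕜) (-1 : DualNumber 𝔸) fun t => by rw [neg_one_mul, mul_neg_one]

/-- [folklore] Components of the `τ₂`-flip. -/
@[simp] theorem c00_flip2 (q : Tau 𝔸) : c00 (flip2 (𝕜 := 𝕜) q) = c00 q := rfl
/-- [folklore] -/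
@[simp] theorem c10_flip2 (q : Tau 𝔸) : c10 (flip2 (𝕜 := 𝕜) q) = c10 q := rfl
/-- [folklore] -/
@[simp] theorem c01_flip2 (q : Tau 𝔸) : c01 (flip2 (𝕜 := 𝕜) q) = -c01 q := by
  show ((-1 : DualNumber 𝔸) * q.snd).fst = -q.snd.fst
  rw [dfst_mul]; simp
/-- [folklore] -/
@[simp] theorem c11_flip2 (q : Tau 𝔸) : c11 (flip2 (𝕜 := 𝕜) q) = -c11 q := by
  show ((-1 : DualNumber 𝔸) * q.snd).snd = -q.snd.snd
  rw [dsnd_mul]; simp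

/-- [folklore] The `τ₂`-flip fixes scalars. -/
@[simp] theorem flip2_ι (a : 𝔸) : flip2 (𝕜 := 𝕜) (ι a) = ι a := ext4 (by simp) (by simp) (by simp) (by simp)

/-- [folklore] The flips on the chart letters: `flip1 (Ebg B B′) = Ebg (−B) B′`, `flip2 (Ebg B B′) = Ebg B (−B′)`, same for `Ebi`. -/
theorem flip1_Ebg (B B' : Form1 d 𝔸) (κ : Fin d) (x : Fin d → ℤ) : flip1 (𝕜 := 𝕜) (Ebg B B' κ x) = Ebg (-B) B' κ x :=
  ext4 (by simp) (by simp) (by simp) (by simp)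
/-- [folklore] -/
theorem flip1_Ebi (B B' : Form1 d 𝔸) (κ : Fin d) (x : Fin d → ℤ) : flip1 (𝕜 := 𝕜) (Ebi B B' κ x) = Ebi (-B) B' κ x :=
  ext4 (by simp) (by simp) (by simp) (by simp)
/-- [folklore] -/
theorem flip2_Ebg (B B' : Form1 d 𝔸) (κ : Fin d) (x : Fin d → ℤ) : flip2 (𝕜 := 𝕜) (Ebg B B' κ x) = Ebg B (-B') κ x :=
  ext4 (by simp) (by simp) (by simp) (by simp)
/-- [folklore] -/
theorem flip2_Ebi (B B' : Form1 d 𝔸) (κ : Fin d) (x : Fin d → ℤ) : flip2 (𝕜 := 𝕜) (Ebi B B' κ x) = Ebi B (-B') κ x :=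
  ext4 (by simp) (by simp) (by simp) (by simp)

/-- [folklore] **`B ↦ −B` IS THE `τ₁`-FLIP** on the rooted jet of a scalar fluctuation. -/
theorem QjetAt_upF_neg_B (ρ : Fin d → ℤ) (W B B' : Form1 d 𝔸) (L : ℕ) (μ : Fin d) (y : Fin d → ℤ) :
    QjetAt 𝕜 ρ (upF W) (-B) B' L μ y = flip1 (𝕜 := 𝕜) (QjetAt 𝕜 ρ (upF W) B B' L μ y) := by
  rw [QjetAt_eq_QjetLAt, QjetAt_eq_QjetLAt, map_QjetLAt]
  simp only [upF, flip1_ι, flip1_Ebg, flip1_Ebi]; rfl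

/-- [folklore] **`B′ ↦ −B′` IS THE `τ₂`-FLIP** on the rooted jet of a scalar fluctuation. -/
theorem QjetAt_upF_neg_B' (ρ : Fin d → ℤ) (W B B' : Form1 d 𝔸) (L : ℕ) (μ : Fin d) (y : Fin d → ℤ) :
    QjetAt 𝕜 ρ (upF W) B (-B') L μ y = flip2 (𝕜 := 𝕜) (QjetAt 𝕜 ρ (upF W) B B' L μ y) := by
  rw [QjetAt_eq_QjetLAt, QjetAt_eq_QjetLAt, map_QjetLAt]
  simp only [upF, flip2_ι, flip2_Ebg, flip2_Ebi]; rfl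

variable (𝕜) in
/-- [folklore] **THE SECOND-ORDER RESPONSE IS ODD IN EACH BACKGROUND**: `T2At ρ (upF W) (−B) B′ = −T2At ρ (upF W) B B′`. -/
theorem T2At_upF_neg_B (ρ : Fin d → ℤ) (W B B' : Form1 d 𝔸) (L : ℕ) (μ : Fin d) (y : Fin d → ℤ) :
    T2At 𝕜 ρ (upF W) (-B) B' L μ y = -T2At 𝕜 ρ (upF W) B B' L μ y := by
  simp only [T2At, QjetAt_upF_neg_B, QjetAt_upF_neg_B', RootedJetTwist.c11_flip1, c11_flip2, neg_add]

variable (𝕜) in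
/-- [folklore] … and `T2At ρ (upF W) B (−B′) = −T2At ρ (upF W) B B′`. -/
theorem T2At_upF_neg_B' (ρ : Fin d → ℤ) (W B B' : Form1 d 𝔸) (L : ℕ) (μ : Fin d) (y : Fin d → ℤ) :
    T2At 𝕜 ρ (upF W) B (-B') L μ y = -T2At 𝕜 ρ (upF W) B B' L μ y := by
  rw [T2At_symm, T2At_upF_neg_B, T2At_symm]

/-! ## §3 The normalised one-parameter computation (rooted) -/

/-- [folklore] The projection `Tau 𝔸 → 𝔸[ε]` onto the `τ₁`-line: `q ↦ (c00 q, c10 q)`. -/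
def pr1 : Tau 𝔸 →ₐ[𝕜] DualNumber 𝔸 := TrivSqZeroExt.fstHom 𝕜 (DualNumber 𝔸) (DualNumber 𝔸)
/-- [folklore] The projection `Tau 𝔸 → 𝔸[ε]` onto the `τ₂`-line: `q ↦ (c00 q, c01 q)`. -/
def pr2 : Tau 𝔸 →ₐ[𝕜] DualNumber 𝔸 := mapDual (TrivSqZeroExt.fstHom 𝕜 𝔸 𝔸)

/-- [folklore] Components of the projections. -/
@[simp] theorem fst_pr1 (q : Tau 𝔸) : (pr1 (𝕜 := 𝕜) q).fst = c00 q := rfl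
/-- [folklore] -/
@[simp] theorem snd_pr1 (q : Tau 𝔸) : (pr1 (𝕜 := 𝕜) q).snd = c10 q := rfl
/-- [folklore] -/
@[simp] theorem fst_pr2 (q : Tau 𝔸) : (pr2 (𝕜 := 𝕜) q).fst = c00 q := rfl
/-- [folklore] -/
@[simp] theorem snd_pr2 (q : Tau 𝔸) : (pr2 (𝕜 := 𝕜) q).snd = c01 q := rfl

section OneParameter

variable {L : ℕ} (hL : (L : 𝕜) ≠ 0) (h2 : (2 : 𝕜) ≠ 0)
include hL

/-- [folklore] `c10 Φ^ρ(Y(W;B)) = ℓ⁻¹ • Z_B` (projection `pr1`: `Y(W;B) ↦ 1 + εB`; 33M3a `snd_PhiGAt_X1`). -/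
theorem c10_PhiGAt_Y (ρ : Fin d → ℤ) (W B : Form1 d 𝔸) (μ : Fin d) (y : Fin d → ℤ) :
    c10 (PhiGAt 𝕜 ρ (Yf W B) (Yb W B) L μ y) = ((L : 𝕜) ^ d)⁻¹ • linAvgAt ρ B L μ y := by
  have hf : (fun κ x => pr1 (𝕜 := 𝕜) (Yf W B κ x)) = X1 B := by
    funext κ x; exact TrivSqZeroExt.ext (by simp [Yf, X1]) (by simp [Yf, X1])
  have hb : (fun κ x => pr1 (𝕜 := 𝕜) (Yb W B κ x)) = X1b B := by
    funext κ x; exact TrivSqZeroExt.ext (by simp [Yb, X1b]) (by simp [Yb, X1b])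
  have key := congrArg TrivSqZeroExt.snd (map_PhiGAt (pr1 (𝕜 := 𝕜)) ρ (Yf W B) (Yb W B) L μ y)
  rw [hf, hb, snd_PhiGAt_X1 ρ B hL, snd_pr1] at key
  exact key

/-- [folklore] `c01 Φ^ρ(Y(W;B)) = ℓ⁻¹ • Z_W` (projection `pr2`: `Y(W;B) ↦ 1 + εW`). -/
theorem c01_PhiGAt_Y (ρ : Fin d → ℤ) (W B : Form1 d 𝔸) (μ : Fin d) (y : Fin d → ℤ) :
    c01 (PhiGAt 𝕜 ρ (Yf W B) (Yb W B) L μ y) = ((L : 𝕜) ^ d)⁻¹ • linAvgAt ρ W L μ y := by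
  have hf : (fun κ x => pr2 (𝕜 := 𝕜) (Yf W B κ x)) = X1 W := by
    funext κ x; exact TrivSqZeroExt.ext (by simp [Yf, X1]) (by simp [Yf, X1])
  have hb : (fun κ x => pr2 (𝕜 := 𝕜) (Yb W B κ x)) = X1b W := by
    funext κ x; exact TrivSqZeroExt.ext (by simp [Yb, X1b]) (by simp [Yb, X1b])
  have key := congrArg TrivSqZeroExt.snd (map_PhiGAt (pr2 (𝕜 := 𝕜)) ρ (Yf W B) (Yb W B) L μ y)
  rw [hf, hb, snd_PhiGAt_X1 ρ W hL, snd_pr2] at key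
  exact key

/-- [folklore] THE FLUCTUATION-FREE REFERENCE: `Φ^ρ(Y(0;B)) = mk 1 (ℓ⁻¹ • Z_B) 0 0` (it lies on the `τ₁`-line: 33H `lineHom`,
33M3a `PhiGAt_X1`). -/
theorem PhiGAt_Y_zero (ρ : Fin d → ℤ) (B : Form1 d 𝔸) (μ : Fin d) (y : Fin d → ℤ) :
    PhiGAt 𝕜 ρ (Yf 0 B) (Yb 0 B) L μ y = mk 1 (((L : 𝕜) ^ d)⁻¹ • linAvgAt ρ B L μ y) 0 0 := by
  have hf : (Yf (0 : Form1 d 𝔸) B) = fun κ x => lineHom (𝕜 := 𝕜) (X1 B κ x) := by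
    funext κ x; exact ext4 (by simp [Yf, X1]) (by simp [Yf, X1]) (by simp [Yf, X1]) (by simp [Yf, X1])
  have hb : (Yb (0 : Form1 d 𝔸) B) = fun κ x => lineHom (𝕜 := 𝕜) (X1b B κ x) := by
    funext κ x; exact ext4 (by simp [Yb, X1b]) (by simp [Yb, X1b]) (by simp [Yb, X1b]) (by simp [Yb, X1b])
  rw [hf, hb, ← map_PhiGAt (lineHom (𝕜 := 𝕜)) ρ (X1 B) (X1b B) L μ y, PhiGAt_X1, inv_smul_sum_box_loopCAt ρ B hL,
    add_sub_cancel]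
  exact ext4 (by simp) (by simp) (by simp) (by simp)

omit hL in
/-- [folklore] For group-like `q`: `c11 q = c11 (logT q) + ½ {c10 q, c01 q}` (node 12 `logT_of_c00`, solved for `c11 q`). -/
theorem c11_eq_logT_add (q : Tau 𝔸) (h : c00 q = 1) :
    c11 q = c11 (logT 𝕜 q) + (2 : 𝕜)⁻¹ • (c10 q * c01 q + c01 q * c10 q) := by
  rw [logT_of_c00 q h, c11_mk, sub_add_cancel]

include h2 in
/-- [folklore] **THE NORMALISED ONE-PARAMETER COMPUTATION (rooted twin of node 12 `c11_logT_PhiY`)**: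
`c11 logT (Φ^ρ(Y(W;B)) · Φ^ρ(Y(0;B))⁻¹) = (2ℓ²)⁻¹ • vhUAt ρ W B` — node 7aρ's rooted field–multiplier functional. -/
theorem c11_logT_PhiGAt_Y_norm (ρ : Fin d → ℤ) (W B : Form1 d 𝔸) (μ : Fin d) (y : Fin d → ℤ) :
    c11 (logT 𝕜 (PhiGAt 𝕜 ρ (Yf W B) (Yb W B) L μ y * invT (PhiGAt 𝕜 ρ (Yf 0 B) (Yb 0 B) L μ y)))
      = ((2 : 𝕜) * (L : 𝕜) ^ (2 * d))⁻¹ • vhUAt ρ W B L μ y := by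
  have hℓ : ((L : 𝕜) ^ d) ≠ 0 := pow_ne_zero d hL
  have h00 : c00 (PhiGAt 𝕜 ρ (Yf W B) (Yb W B) L μ y) = 1 :=
    c00_PhiGAt (fun κ x => by simp [Yf]) (fun κ x => by simp [Yb]) ρ L μ y
  have h11 := c11_eq_logT_add (𝕜 := 𝕜) _ h00
  have hq : c00 (PhiGAt 𝕜 ρ (Yf W B) (Yb W B) L μ y * mk 1 (-(((L : 𝕜) ^ d)⁻¹ • linAvgAt ρ B L μ y)) 0 0) = 1 := by
    simp [h00]
  rw [PhiGAt_Y_zero hL ρ B μ y, invT_mk_one, logT_of_c00 _ hq, c11_mk]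
  simp only [c10_mul, c01_mul, c11_mul, c00_mk, c10_mk, c01_mk, c11_mk, h00, h11, c10_PhiGAt_Y hL,
    c01_PhiGAt_Y hL, c11_logT_PhiGAt_Y ρ W B hL h2, mul_one, one_mul, mul_zero, zero_mul, add_zero, zero_add,
    neg_add_cancel, smul_zero, sub_zero]
  simp only [vhUAt, AveragingHessianKernels.comm, ← Int.cast_smul_eq_zsmul 𝕜 ((L : ℤ) ^ d), Int.cast_pow, Int.cast_natCast,
    smul_add, smul_sub, mul_neg, smul_mul_assoc, mul_smul_comm, smul_smul, pow_mul', sq]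
  match_scalars <;> (field_simp; try ring)

end OneParameter

/-! ## §4 Orders `B⁰`, `B¹` of the rooted jet of a scalar fluctuation -/

section Orders

variable {L : ℕ} (hL : (L : 𝕜) ≠ 0) (h2 : (2 : 𝕜) ≠ 0)
include hL

/-- [folklore] **ORDER `B⁰` (rooted `c00_Qjet`)**: `c00 Q^ρ(upF W; B, B′) = ℓ⁻¹ • linAvgAt ρ W`. -/
theorem c00_QjetAt_upF (ρ : Fin d → ℤ) (W B B' : Form1 d 𝔸) (μ : Fin d) (y : Fin d → ℤ) :
    c00 (QjetAt 𝕜 ρ (upF W) B B' L μ y) = ((L : 𝕜) ^ d)⁻¹ • linAvgAt ρ W L μ y := by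
  have hG : ∀ κ x, mapDual (Tau.aug (𝕜 := 𝕜)) (Gf (upF W) B B' κ x) = X1 W κ x :=
    fun κ x => TrivSqZeroExt.ext (by simp [X1]) (by simp [X1])
  have hGb : ∀ κ x, mapDual (Tau.aug (𝕜 := 𝕜)) (Gb (upF W) B B' κ x) = X1b W κ x :=
    fun κ x => TrivSqZeroExt.ext (by simp [X1b]) (by simp [X1b])
  have hG0 : ∀ κ x, mapDual (Tau.aug (𝕜 := 𝕜)) (Gf 0 B B' κ x) = 1 := fun κ x => TrivSqZeroExt.ext (by simp) (by simp)
  have hGb0 : ∀ κ x, mapDual (Tau.aug (𝕜 := 𝕜)) (Gb 0 B B' κ x) = 1 := fun κ x => TrivSqZeroExt.ext (by simp) (by simp)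
  unfold QjetAt PhiRAt
  have key := congrArg TrivSqZeroExt.snd (map_logT (R := Rho 𝔸) (R' := DualNumber 𝔸) (mapDual (Tau.aug (𝕜 := 𝕜)))
    (PhiGAt 𝕜 ρ (Gf (upF W) B B') (Gb (upF W) B B') L μ y * invT (PhiGAt 𝕜 ρ (Gf 0 B B') (Gb 0 B B') L μ y)))
  simp only [map_mul, map_invT, map_PhiGAt, hG, hGb, hG0, hGb0, snd_mapDual, Tau.aug_apply] at key
  rw [PhiGAt_one, invT_one, mul_one] at key
  refine key.trans ?_
  have hX : PhiGAt 𝕜 ρ (fun κ x => X1 W κ x) (fun κ x => X1b W κ x) L μ y = PhiGAt 𝕜 ρ (X1 W) (X1b W) L μ y := rfl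
  rw [hX, PhiGAt_X1, logT_dmk_one, snd_dmk, inv_smul_sum_box_loopCAt ρ W hL, add_sub_cancel]

include h2

/-- [folklore] **ORDER `B¹`, `B`-SLOT (rooted `c10_Qjet`)**: `c10 Q^ρ(upF W; B, B′) = (2ℓ²)⁻¹ • vhUAt ρ W B`. -/
theorem c10_QjetAt_upF (ρ : Fin d → ℤ) (W B B' : Form1 d 𝔸) (μ : Fin d) (y : Fin d → ℤ) :
    c10 (QjetAt 𝕜 ρ (upF W) B B' L μ y) = ((2 : 𝕜) * (L : 𝕜) ^ (2 * d))⁻¹ • vhUAt ρ W B L μ y := by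
  have hG : ∀ κ x, piB (𝕜 := 𝕜) (Gf (upF W) B B' κ x) = Yf W B κ x :=
    fun κ x => ext4 (by simp [Yf]) (by simp [Yf]) (by simp [Yf]) (by simp [Yf])
  have hGb : ∀ κ x, piB (𝕜 := 𝕜) (Gb (upF W) B B' κ x) = Yb W B κ x :=
    fun κ x => ext4 (by simp [Yb]) (by simp [Yb]) (by simp [Yb]) (by simp [Yb])
  have hG0 : ∀ κ x, piB (𝕜 := 𝕜) (Gf 0 B B' κ x) = Yf 0 B κ x :=
    fun κ x => ext4 (by simp [Yf]) (by simp [Yf]) (by simp [Yf]) (by simp [Yf])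
  have hGb0 : ∀ κ x, piB (𝕜 := 𝕜) (Gb 0 B B' κ x) = Yb 0 B κ x :=
    fun κ x => ext4 (by simp [Yb]) (by simp [Yb]) (by simp [Yb]) (by simp [Yb])
  unfold QjetAt PhiRAt
  have key := congrArg c11 (map_logT (R := Rho 𝔸) (R' := Tau 𝔸) (piB (𝕜 := 𝕜))
    (PhiGAt 𝕜 ρ (Gf (upF W) B B') (Gb (upF W) B B') L μ y * invT (PhiGAt 𝕜 ρ (Gf 0 B B') (Gb 0 B B') L μ y)))
  simp only [map_mul, map_invT, map_PhiGAt, hG, hGb, hG0, hGb0] at key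
  rw [piB_apply, c11_mk] at key
  refine key.trans ?_
  exact c11_logT_PhiGAt_Y_norm hL h2 ρ W B μ y

/-- [folklore] **ORDER `B¹`, `B′`-SLOT (rooted `c01_Qjet`)**: `c01 Q^ρ(upF W; B, B′) = (2ℓ²)⁻¹ • vhUAt ρ W B′`. -/
theorem c01_QjetAt_upF (ρ : Fin d → ℤ) (W B B' : Form1 d 𝔸) (μ : Fin d) (y : Fin d → ℤ) :
    c01 (QjetAt 𝕜 ρ (upF W) B B' L μ y) = ((2 : 𝕜) * (L : 𝕜) ^ (2 * d))⁻¹ • vhUAt ρ W B' L μ y := by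
  have hG : ∀ κ x, piB' (𝕜 := 𝕜) (Gf (upF W) B B' κ x) = Yf W B' κ x :=
    fun κ x => ext4 (by simp [Yf]) (by simp [Yf]) (by simp [Yf]) (by simp [Yf])
  have hGb : ∀ κ x, piB' (𝕜 := 𝕜) (Gb (upF W) B B' κ x) = Yb W B' κ x :=
    fun κ x => ext4 (by simp [Yb]) (by simp [Yb]) (by simp [Yb]) (by simp [Yb])
  have hG0 : ∀ κ x, piB' (𝕜 := 𝕜) (Gf 0 B B' κ x) = Yf 0 B' κ x :=
    fun κ x => ext4 (by simp [Yf]) (by simp [Yf]) (by simp [Yf]) (by simp [Yf])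
  have hGb0 : ∀ κ x, piB' (𝕜 := 𝕜) (Gb 0 B B' κ x) = Yb 0 B' κ x :=
    fun κ x => ext4 (by simp [Yb]) (by simp [Yb]) (by simp [Yb]) (by simp [Yb])
  unfold QjetAt PhiRAt
  have key := congrArg c11 (map_logT (R := Rho 𝔸) (R' := Tau 𝔸) (piB' (𝕜 := 𝕜))
    (PhiGAt 𝕜 ρ (Gf (upF W) B B') (Gb (upF W) B B') L μ y * invT (PhiGAt 𝕜 ρ (Gf 0 B B') (Gb 0 B B') L μ y)))
  simp only [map_mul, map_invT, map_PhiGAt, hG, hGb, hG0, hGb0] at key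
  rw [piB'_apply, c11_mk] at key
  refine key.trans ?_
  exact c11_logT_PhiGAt_Y_norm hL h2 ρ W B' μ y

end Orders

/-! ## §5 The background `NR` of the reflected fluctuation-free averaging -/

/-- [folklore] `NR = Φ^ρ(E♯, Ē♯)`: the group part of the lifted averaging at `ω = 0` is the averaging of the backgrounds
(33D `fst_GfL`). -/
theorem NR_eq (ρ : Fin d → ℤ) (α : Fin d) (B B' : Form1 d 𝔸) (L : ℕ) (μ : Fin d) (y : Fin d → ℤ) :
    NR 𝕜 ρ α B B' L μ y
      = PhiGAt 𝕜 ρ (reflPair α (Ebg B B') (Ebi B B')) (reflPair α (Ebi B B') (Ebg B B')) L μ y := by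
  unfold NR PhiLAt
  have key := map_PhiGAt (TrivSqZeroExt.fstHom 𝕜 (Tau 𝔸) (Tau 𝔸)) ρ (GfL 0 (reflPair α (Ebg B B') (Ebi B B')))
    (GbL 0 (reflPair α (Ebi B B') (Ebg B B'))) L μ y
  simp only [TrivSqZeroExt.fstHom_apply, fst_GfL, fst_GbL] at key
  exact key

/-- [folklore] THE REFLECTED BACKGROUND LETTERS IN `Y`-FORM: `E♯ = Y(c; b) + τ₁τ₂ ([b, c] + dR)`, `Ē♯ = Ȳ(c; b) − τ₁τ₂ ([b, c] + dR)`
(33G `reflPair_Ebg_Ebi`). -/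
theorem reflPair_Ebg_Ebi_eq_Yf (α : Fin d) (B B' : Form1 d 𝔸) :
    reflPair α (Ebg B B') (Ebi B B')
      = fun κ x => Yf (R1g α B') (R1g α B) κ x + mk 0 0 0 ((bw (R1g α B) (R1g α B') + dR α B B') κ x) := by
  rw [reflPair_Ebg_Ebi]; funext κ x
  exact ext4 (by simp [Yf]) (by simp [Yf]) (by simp [Yf]) (by simp [Yf, AveragingHessianKernels.comm]; abel)
/-- [folklore] -/
theorem reflPair_Ebi_Ebg_eq_Yb (α : Fin d) (B B' : Form1 d 𝔸) :
    reflPair α (Ebi B B') (Ebg B B')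
      = fun κ x => Yb (R1g α B') (R1g α B) κ x - mk 0 0 0 ((bw (R1g α B) (R1g α B') + dR α B B') κ x) := by
  rw [reflPair_Ebi_Ebg]; funext κ x
  exact ext4 (by simp [Yb]) (by simp [Yb]) (by simp [Yb]) (by simp [Yb, AveragingHessianKernels.comm]; abel)

/-- [folklore] `NR = Φ^ρ(Y(c;b)) + τ₁τ₂ (t(c^ρ) + ℓ⁻¹ Σ_x t(loop^ρ_x))`, `t = [b, c] + dR` (33M3a `PhiGAt_add_top`). -/
theorem NR_eq_PhiGAt_Y_add (ρ : Fin d → ℤ) (α : Fin d) (B B' : Form1 d 𝔸) (L : ℕ) (μ : Fin d) (y : Fin d → ℤ) :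
    NR 𝕜 ρ α B B' L μ y
      = PhiGAt 𝕜 ρ (Yf (R1g α B') (R1g α B)) (Yb (R1g α B') (R1g α B)) L μ y
        + mk 0 0 0 ((segUp (bw (R1g α B) (R1g α B') + dR α B B') ((L : ℤ) • y + ρ) μ L).sum
          + ((L : 𝕜) ^ d)⁻¹ • ∑ b ∈ box d L, (loopCAt ρ (bw (R1g α B) (R1g α B') + dR α B B') L μ y b).sum) := by
  rw [NR_eq, reflPair_Ebg_Ebi_eq_Yf, reflPair_Ebi_Ebg_eq_Yb]
  exact PhiGAt_add_top (fun κ x => by simp [Yf]) (fun κ x => by simp [Yb]) _ ρ L μ y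

section NRComponents

variable {L : ℕ} (hL : (L : 𝕜) ≠ 0) (h2 : (2 : 𝕜) ≠ 0)
include hL

/-- [folklore] `c10 NR = ℓ⁻¹ • Z_b`. -/
theorem c10_NR (ρ : Fin d → ℤ) (α : Fin d) (B B' : Form1 d 𝔸) (μ : Fin d) (y : Fin d → ℤ) :
    c10 (NR 𝕜 ρ α B B' L μ y) = ((L : 𝕜) ^ d)⁻¹ • linAvgAt ρ (R1g α B) L μ y := by
  rw [NR_eq_PhiGAt_Y_add, c10_add, c10_mk, add_zero, c10_PhiGAt_Y hL]

/-- [folklore] `c01 NR = ℓ⁻¹ • Z_c`. -/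
theorem c01_NR (ρ : Fin d → ℤ) (α : Fin d) (B B' : Form1 d 𝔸) (μ : Fin d) (y : Fin d → ℤ) :
    c01 (NR 𝕜 ρ α B B' L μ y) = ((L : 𝕜) ^ d)⁻¹ • linAvgAt ρ (R1g α B') L μ y := by
  rw [NR_eq_PhiGAt_Y_add, c01_add, c01_mk, add_zero, c01_PhiGAt_Y hL]

include h2 in
/-- [folklore] **`c11 NR = (2ℓ)⁻¹ • (hessUAt ρ b c + Z[b,c]) + ℓ⁻¹ • Z(dR) + (2ℓ²)⁻¹ • {Z_b, Z_c}`** (33M3a `c11_logT_PhiGAt_Y`,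
`hessUAt_symm`, `linAvgAt_bw_swap`). -/
theorem c11_NR (ρ : Fin d → ℤ) (α : Fin d) (B B' : Form1 d 𝔸) (μ : Fin d) (y : Fin d → ℤ) :
    c11 (NR 𝕜 ρ α B B' L μ y)
      = ((2 : 𝕜) * (L : 𝕜) ^ d)⁻¹ • (hessUAt ρ (R1g α B) (R1g α B') L μ y + linAvgAt ρ (bw (R1g α B) (R1g α B')) L μ y)
        + ((L : 𝕜) ^ d)⁻¹ • linAvgAt ρ (dR α B B') L μ y
        + ((2 : 𝕜) * (L : 𝕜) ^ (2 * d))⁻¹ • (linAvgAt ρ (R1g α B) L μ y * linAvgAt ρ (R1g α B') L μ y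
            + linAvgAt ρ (R1g α B') L μ y * linAvgAt ρ (R1g α B) L μ y) := by
  have hℓ : ((L : 𝕜) ^ d) ≠ 0 := pow_ne_zero d hL
  have h00 : c00 (PhiGAt 𝕜 ρ (Yf (R1g α B') (R1g α B)) (Yb (R1g α B') (R1g α B)) L μ y) = 1 :=
    c00_PhiGAt (fun κ x => by simp [Yf]) (fun κ x => by simp [Yb]) ρ L μ y
  have hZ : linAvgAt ρ (bw (R1g α B) (R1g α B') + dR α B B') L μ y
      = linAvgAt ρ (bw (R1g α B) (R1g α B')) L μ y + linAvgAt ρ (dR α B B') L μ y := by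
    have h := linAvgAt_sub ρ (bw (R1g α B) (R1g α B') + dR α B B') (dR α B B') L μ y
    rw [add_sub_cancel_right] at h
    exact eq_add_of_sub_eq h.symm
  rw [NR_eq_PhiGAt_Y_add, c11_add, c11_mk, inv_smul_sum_box_loopCAt ρ _ hL, add_sub_cancel, c11_eq_logT_add (𝕜 := 𝕜) _ h00,
    c11_logT_PhiGAt_Y ρ _ _ hL h2, c10_PhiGAt_Y hL, c01_PhiGAt_Y hL, hessUAt_symm ρ (R1g α B) (R1g α B'),
    linAvgAt_bw_swap ρ (R1g α B) (R1g α B'), hZ]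
  simp only [smul_add, smul_neg, smul_mul_assoc, mul_smul_comm, smul_smul, pow_mul', sq]
  match_scalars <;> (field_simp; try ring)

end NRComponents

end Summit.QuantumFields.BalabanUV.Beta.RootedT2JetDictionary
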